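import Mathlib
import Literature.NumberTheory.Transcendental.BoxIntegralZetaValues
import HarnessLib

/-!
# Tosi 2026: the basic cellular integrals `ξ_l = ∫_{[0,1]^l} dx/((1−x₁x₂)(1−x₂x₃)⋯(1−x_{l−1}x_l))` in closed form

Topic `Literature/NumberTheory/Irrationality/Tosi2026`. Typed, cited statement (ONE named fact, no proof; D-0014) with
DEFINITIONS and PROVED companions, read on the page (this session, arXiv PDF v2 of 19 Mar 2026) from R. Tosi, *An explicit
study of a family of cellular integrals*, arXiv:2601.00346 [Tosi2026]. Context: F. Brown's programme of cellular integrals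
on `M_{0,n}` [Brown2016] (tree: `Irrationality/Brown2016/*`, the convergent configurations; `Irrationality/BrownZudilin2022/*`,
the `ζ(5)` family); this paper computes "the simplest possible cellular integrals, corresponding … to the choice
`f₁ = ⋯ = f_r = 1`", answering "a question of Brown [Bro09, Remark 8.7]" (p. 2).

HONEST FRAMING (cells pub-zeta5 / zeta5-irr): systematic search; no irrationality claim unless certified. The integrals `ξ_l`
are rational multiples of even powers of `π`; nothing here concerns `ζ(5)`.

## What is printed (arXiv v2 page numbers)

* p. 2: "In suitable coordinates, for `l ≥ 2` these integrals are given by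
  `ξ_l = ∫_{[0,1]^l} 1/((1 − x₁x₂)(1 − x₂x₃)⋯(1 − x_{l−1}x_l)) dx₁ … dx_l`."
* **Theorem 1** (p. 2). "For all `m ≥ 1`, the integrals `ξ_{2m}` fit into the following generating series:
  `1 + Σ_{n=1}^{∞} ξ_{2n} tⁿ = arcsin(π√t)/(π√t)`. Moreover, `ξ_{2m+1} = Σ_{h=0}^{m} ξ_{2h} ξ_{2m−2h}`.
  In particular, each `ξ_l` is a rational multiple of `π^l` for `l` even and of `π^{l−1}` for `l` odd. For `l = 2m`, we deduce the
  following formula: `ξ_{2m} = (2m)!/(4^m (m!)² (2m+1)) · π^{2m}`."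
  (The constant term `1` of the series is `ξ₀`: Proposition 31 / Corollary 25, `1 + Σ ξ_{2n}tⁿ = B₁(t)`, p. 35; the odd
  relation is `B₂ = B₁²`, Lemma 24, and includes both end terms `h = 0`, `h = m` — e.g. "Theorem 1 predicts the relation
  `ξ₃ = 2ξ₂`", p. 10, and `∫_{Δ₃} ω₃ = ζ(2) + Li₂(1) = 2ζ(2)`, p. 18; `∫_{Δ₂} ω₂ = Li₂(1) = ζ(2)`, p. 17.)
* Proposition 4 (p. 7): `ξ_l` is a `ℚ`-linear combination of multiple zeta values of weight exactly `l` (`l` even), at most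
  `l − 1` (`l` odd) [NOT typed: superseded by Theorem 1 for these integrals]. Closing comparison (p. 36): the Zlobin-type
  integrals `I_l = ∫_{[0,1]^l} x_l^{l−2}/((1−x₁x_l)⋯(1−x_{l−1}x_l)) = (l−1)! ζ(l)` [NOT typed: a sketch].

## What is typed

DEFINITIONS `box l` (the open unit box of `Fin l → ℝ`, the tree's shape of `Transcendental.BoxIntegral`), `omegaDensity l`
(the integrand `∏_{i+1<l} (1 − x_i x_{i+1})^{−1}`, so that `l = 0, 1` give `1`), `xi l = ξ_l` (Lebesgue set integral; the
printed closed box `[0,1]^l` differs by a null set). NAMED FACT `theorem1` = Theorem 1 as the conjunction of its three displayed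
clauses (generating series on `0 < t < π^{−2}`, written without the constant term; the odd relation; the closed formula).
PROVED: `xi_zero` (`ξ₀ = 1`, the constant term), `xi_two` (`ξ₂ = π²/6` UNCONDITIONALLY, from the tree's
`Transcendental.box_integral_one_div_one_sub_mul_two` — the case `m = 1` of the closed formula), and from the fact:
`theorem1.xi_even_ratMul`, `theorem1.xi_odd_ratMul` ("each `ξ_l` is a rational multiple of `π^l` for `l` even and of `π^{l−1}`
for `l` odd"), `theorem1.xi_three` (`ξ₃ = π²/3 = 2ζ(2)`), `theorem1.xi_four` (`ξ₄ = 3π⁴/40`).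
-/

noncomputable section

open MeasureTheory Set Finset

namespace Literature.NumberTheory.Irrationality.Tosi2026

/-- The open unit box `(0,1)^l` of `Fin l → ℝ` (the shape of `Transcendental.BoxIntegral`; the printed domain `[0,1]^l`
differs by a Lebesgue-null set). [cite: Tosi2026, §2.2 p. 17 ("From now on we set `Δ_l = [0,1]^l`")] -/
def box (l : ℕ) : Set (Fin l → ℝ) := {x | ∀ i, x i ∈ Ioo (0 : ℝ) 1}

/-- The integrand `1/((1 − x₁x₂)(1 − x₂x₃)⋯(1 − x_{l−1}x_l))` of `ξ_l` = the cellular volume form `ω_l` in cubical coordinates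
(empty product, i.e. `1`, for `l ≤ 1`). [cite: Tosi2026, Introduction p. 2; §1.1 p. 6 (`ω_l = dx₁…dx_l/((1−x₁x₂)⋯(1−x_{l−1}x_l))`)] -/
def omegaDensity (l : ℕ) (x : Fin l → ℝ) : ℝ :=
  ∏ i : Fin l, if h : i.1 + 1 < l then 1 / (1 - x i * x ⟨i.1 + 1, h⟩) else 1

/-- **`ξ_l = ∫_{[0,1]^l} dx₁⋯dx_l/((1 − x₁x₂)(1 − x₂x₃)⋯(1 − x_{l−1}x_l))`**, the basic cellular integral (for `l` even "a
cellular integral in the sense of [Bro16] … for it corresponds to the configuration `i ↦ i + 2`", p. 7).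
[cite: Tosi2026, Introduction p. 2 (definition of `ξ_l`), Proposition 4 (`ξ_l = ∫ ω_l`)] -/
def xi (l : ℕ) : ℝ := ∫ x in box l, omegaDensity l x

/-- `ξ₀ = 1` (the zero-dimensional box has volume `1`; this is the constant term "`1 +`" of the generating series of
Theorem 1 and `β₁^{(2)} = 1`). [cite: Tosi2026, Theorem 1; §2.4 p. 35 (`1 + Σ ξ_{2n}tⁿ = Σ β₁^{(2+2n)} tⁿ`)] -/
theorem xi_zero : xi 0 = 1 := by
  have hbox : box 0 = Set.univ := by
    ext x; simp [box]
  have hvol : (volume : Measure (Fin 0 → ℝ)) Set.univ = 1 := by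
    rw [volume_pi, Measure.pi_univ]; simp
  simp [xi, hbox, omegaDensity, Measure.real, hvol]

/-- **`ξ₂ = ζ(2) = π²/6`** (PROVED, from the tree's `∫_{(0,1)²} dxdy/(1−xy) = π²/6`): "We conclude that
`∫_{Δ₂} ω₂ = Li₂(1) = ζ(2)`" — the case `m = 1` of the closed formula of Theorem 1 (`2!/(4·1·3) π² = π²/6`).
[cite: Tosi2026, §2.2 p. 17] -/
theorem xi_two : xi 2 = Real.pi ^ 2 / 6 := by
  have h := (Literature.NumberTheory.Transcendental.box_integral_one_div_one_sub_mul_two).2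
  have hfun : omegaDensity 2 = fun x : Fin 2 → ℝ => 1 / (1 - x 0 * x 1) := by
    funext x
    simp [omegaDensity, Fin.mk_one]
  rw [xi, hfun]
  exact h

/-- **Theorem 1** (Tosi 2026; named fact, statement only), its three displayed clauses:
(i) the generating series `1 + Σ_{n≥1} ξ_{2n} tⁿ = arcsin(π√t)/(π√t)` (typed for `0 < t < π^{−2}`, without the constant term);
(ii) `ξ_{2m+1} = Σ_{h=0}^{m} ξ_{2h} ξ_{2m−2h}` for `m ≥ 1` (with `ξ₀ = 1`, `xi_zero`);
(iii) `ξ_{2m} = (2m)!/(4^m (m!)² (2m+1)) · π^{2m}` for `m ≥ 1`.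
[cite: Tosi2026, Theorem 1 (p. 2); proof §2.4 pp. 34–36 (Proposition 31, Corollary 32, Corollary 25 with [Hof17])] -/
def theorem1 : Prop :=
  (∀ t : ℝ, 0 < t → t < 1 / Real.pi ^ 2 →
      HasSum (fun n : ℕ => xi (2 * (n + 1)) * t ^ (n + 1))
        (Real.arcsin (Real.pi * Real.sqrt t) / (Real.pi * Real.sqrt t) - 1)) ∧
  (∀ m : ℕ, 1 ≤ m → xi (2 * m + 1) = ∑ h ∈ Finset.range (m + 1), xi (2 * h) * xi (2 * m - 2 * h)) ∧
  (∀ m : ℕ, 1 ≤ m →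
      xi (2 * m) = (Nat.factorial (2 * m) : ℝ) / (4 ^ m * (Nat.factorial m : ℝ) ^ 2 * (2 * m + 1)) * Real.pi ^ (2 * m))

/-- "each `ξ_l` is a rational multiple of `π^l` for `l` even" (from clause (iii)). [cite: Tosi2026, Theorem 1 (p. 2)] -/
theorem theorem1.xi_even_ratMul (hT : theorem1) {m : ℕ} (hm : 1 ≤ m) :
    ∃ q : ℚ, xi (2 * m) = q * Real.pi ^ (2 * m) := by
  obtain ⟨-, -, h3⟩ := hT
  refine ⟨(Nat.factorial (2 * m) : ℚ) / (4 ^ m * (Nat.factorial m : ℚ) ^ 2 * (2 * m + 1)), ?_⟩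
  rw [h3 m hm]
  push_cast
  ring

/-- "… and of `π^{l−1}` for `l` odd" (from clauses (ii), (iii) and `ξ₀ = 1`). [cite: Tosi2026, Theorem 1 (p. 2)] -/
theorem theorem1.xi_odd_ratMul (hT : theorem1) {m : ℕ} (hm : 1 ≤ m) :
    ∃ q : ℚ, xi (2 * m + 1) = q * Real.pi ^ (2 * m) := by
  have hev : ∀ k : ℕ, ∃ q : ℚ, xi (2 * k) = q * Real.pi ^ (2 * k) := by
    intro k
    rcases Nat.eq_zero_or_pos k with rfl | hk
    · exact ⟨1, by simp [xi_zero]⟩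
    · exact hT.xi_even_ratMul hk
  choose q hq using hev
  obtain ⟨-, h2, -⟩ := hT
  refine ⟨∑ k ∈ Finset.range (m + 1), q k * q (m - k), ?_⟩
  rw [h2 m hm]
  push_cast
  rw [Finset.sum_mul]
  refine Finset.sum_congr rfl fun k hk => ?_
  have hk' : k ≤ m := Nat.lt_succ_iff.mp (Finset.mem_range.mp hk)
  rw [hq k, show 2 * m - 2 * k = 2 * (m - k) by omega, hq (m - k),
    show Real.pi ^ (2 * m) = Real.pi ^ (2 * k) * Real.pi ^ (2 * (m - k)) by
      rw [← pow_add]; congr 1; omega]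
  ring

/-- `ξ₃ = 2ξ₂ = π²/3` ("Theorem 1 predicts the relation `ξ₃ = 2ξ₂`"; `∫_{Δ₃} ω₃ = ζ(2) + Li₂(1) = 2ζ(2)`), from clause (ii)
at `m = 1` and the PROVED values `ξ₀ = 1`, `ξ₂ = π²/6`. [cite: Tosi2026, §1.3 p. 10 and §2.2 p. 18] -/
theorem theorem1.xi_three (hT : theorem1) : xi 3 = Real.pi ^ 2 / 3 := by
  obtain ⟨-, h2, -⟩ := hT
  have e := h2 1 le_rfl
  norm_num [Finset.sum_range_succ, xi_zero, xi_two] at e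
  linarith

/-- `ξ₄ = 3π⁴/40` (clause (iii) at `m = 2`: `4!/(16·4·5) = 3/40`; the `t²`-coefficient of `arcsin(x)/x = 1 + x²/6 + 3x⁴/40 + ⋯`).
[cite: Tosi2026, Theorem 1 (p. 2)] -/
theorem theorem1.xi_four (hT : theorem1) : xi 4 = 3 * Real.pi ^ 4 / 40 := by
  obtain ⟨-, -, h3⟩ := hT
  have e := h3 2 (by norm_num)
  norm_num [Nat.factorial] at e
  linarith

end Literature.NumberTheory.Irrationality.Tosi2026

end
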